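import Literature.Computability.Complexity.PCPToCMMSA
import Literature.Computability.Complexity.CNFToCMMSAMachine
import Literature.Computability.Complexity.CodeFPLists
import Literature.Computability.Complexity.ClayProblemProofs
import HarnessLib

/-!
# A PCP verifier's checks as constant-gap CMMSA, II: the Karp reduction and NP-hardness from the PCP theorem

Topic `Computability/Complexity`. The map `x ↦ PCPToCMMSA.toCMMSA V x (c log₂|x| + c)` of
`PCPToCMMSA.lean` is computed by a polynomial-time string function for every polynomial-time
verifier `V` (`PCPVerifier.IsPolyTime`) with `O(1)` queries: the `2^{c log₂ n + c} ≤ 2^c (n+1)^c`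
coin strings are enumerated by value (`PCPExact.coinStr`, the brick `padTakeFn`), the verifier's
query and decision maps enter as the `FP` atoms `PCPExact.QF`, `PCPExact.DF` of `PCPSubsetNP.lean`,
and the rest is `CodeFP` plumbing (`CodeFP*.lean`, `CNFToCMMSAMachine.lean`). With the PCP theorem
(`pcp_theorem_exact`: Arora–Barak 2009, Thm. 11.5) applied to `3SAT` (Cook–Levin,
`isNPComplete_kSAT_three_holds`) this gives an NP-hard constant-gap CMMSA problem of constant degree,
`gapCMMSA (gapQ q) 1 (2^q · q)` — the gap form of the PCP theorem (Arora–Barak, Thm. 11.9) in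
Hirahara's interface.

* `PCPToCMMSA.codeFP_coinStrings`, `codeFP_queries`, `codeFP_decide`, `strBits`, `codeFP_formulaT`;
* `PCPToCMMSA.codeFP_toCMMSA` — **the instance map is polynomial time**;
* `PCPToCMMSA.polyTimeReducible_of_mem_PCPExact` — `L ≤ₚ gapCMMSA (gapQ q) 1 (2^q·q)` for
  `L ∈ PCPExact (c log₂ n + c) q`;
* `PCPToCMMSA.isNPHard_gapCMMSA_of_pcp_theorem` — **from `pcp_theorem_exact`, some
  `gapCMMSA (gapQ q) 1 (2^q · q)` is NP-hard.**

## References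

* S. Arora, B. Barak, *Computational Complexity: A Modern Approach*, CUP 2009, Thm. 11.5, Thm. 11.9,
  Remark 11.6(3), §1.3 [AroraBarakCC2009].
* S. Hirahara, *NP-hardness of learning programs and partial MCSP*, ECCC TR22-119, Def. 5.1, proof
  of Thm. 5.2 [Hirahara2022PartialMCSP].
* M. Alekhnovich, S. Buss, S. Moran, T. Pitassi, *Minimum propositional proof length is NP-hard to
  linearly approximate*, J. Symbolic Logic 66 (2001), §2 [AlekhnovichEtAl2001].
-/

namespace Literature.Computability.Complexity

open _root_.Computability MetaComplexity CodeFP Polynomial CNFToCMMSA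
open CSPToCMMSAMachine (TO toE toE_eq)

namespace PCPToCMMSA

/-! ### Small atoms -/

/-- `encodingListNatBool` codes by `listE natE`. [folklore] -/
theorem listNatE_eq : (encodingListNatBool.encode : List ℕ → List Bool) = listE natE := by
  rw [show (encodingListNatBool : Encoding (List ℕ) Bool) = encodingNatBool.listBool from rfl, listE_eq, natE_eq]

/-- `m(x)` in unary (`PCPExact.unaryCoinsF`). [cite: AroraBarakCC2009, Remark 11.6(3)] -/
theorem codeFP_mOf (c : ℕ) : CodeFP strE unE (mOf c) :=
  of_fn (PCPExact.unaryCoinsF c) (PCPExact.unaryCoinsF_mem_FP c) fun x => by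
    rw [PCPExact.unaryCoinsF_apply, unE_eq_ones]; rfl

/-- The budget in unary. [folklore] -/
theorem codeFP_budget (c : ℕ) : CodeFP strE unE (budget c) :=
  ((ulength unitE).comp (unitsMul.comp ((const strE (List.replicate (2 ^ c) ())).pair
    ((unitsPow c).comp (unSucc.comp strLength))))).congr fun x => by simp [budget]

/-- The `i`-th coin string of length `m` from `(1ᵐ, i)` (the brick `padTakeFn`). [folklore] -/
theorem codeFP_coinStr : CodeFP (pairE unE natE) strE (fun p => PCPExact.coinStr p.1 p.2) :=
  of_fn (Brick.fstF ∘ Brick.padTakeFn) (comp_mem_FP Brick.fstF_mem_FP Brick.padTakeFn_mem_FP) fun p => by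
    simp [pairE_apply, PCPExact.coinStr]

/-- The coin strings `(1ᵐ, 1ᴮ) ↦ coinStrings m` given a unary budget `B ≥ 2^m`. [folklore] -/
theorem codeFP_coinStringsOf :
    CodeFP (pairE unE unE) (rawE strE) (fun p => (List.range (min (2 ^ p.1) p.2)).map (PCPExact.coinStr p.1)) := by
  have h2m : CodeFP (pairE unE unE) natE (fun p => 2 ^ p.1) := natPow.comp ((const _ 2).pair (fst _ _))
  have hrange : CodeFP (pairE unE unE) (rawE natE) (fun p => List.range (min (2 ^ p.1) p.2)) :=
    rangeOf.comp ((snd _ _).pair h2m)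
  exact ((map codeFP_coinStr).comp ((fst _ _).pair hrange)).congr fun _ => rfl

/-- **All coin strings of the input**: `x ↦ coinStrings (m(x))`. [cite: AroraBarakCC2009, Remark 11.6(3)] -/
theorem codeFP_coinStrings (c : ℕ) : CodeFP strE (rawE strE) (fun x => coinStrings (mOf c x)) :=
  (codeFP_coinStringsOf.comp ((codeFP_mOf c).pair (codeFP_budget c))).congr fun x => by
    simp only [coinStrings]
    rw [min_eq_left (two_pow_mOf_le c x)]

/-- **The verifier's queries** as a typed atom (`PCPExact.QF`). [cite: AroraBarakCC2009, Def. 11.4] -/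
theorem codeFP_queries {V : PCPVerifier} (hV : V.IsPolyTime) :
    CodeFP (pairE strE strE) (rawE natE) (fun p => V.queries p.1 p.2) := by
  have h : CodeFP (pairE strE strE) (listE natE) (fun p => V.queries p.1 p.2) :=
    of_fn (PCPExact.QF V) (PCPExact.QF_mem_FP hV) fun p => by
      show PCPExact.QF V (boolPair p.1 p.2) = listE natE (V.queries p.1 p.2)
      rw [PCPExact.QF_boolPair, listNatE_eq]
  exact ((rawOfList natE).comp h).congr fun _ => rfl

/-- **The verifier's decision** as a typed atom (`PCPExact.DF`). [cite: AroraBarakCC2009, Def. 11.4] -/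
theorem codeFP_decide {V : PCPVerifier} (hV : V.IsPolyTime) :
    CodeFP (pairE strE (pairE strE strE)) bitE (fun p => V.decide p.1 p.2.1 p.2.2) :=
  of_fn (PCPExact.DF V) (PCPExact.DF_mem_FP hV) fun p => by
    show PCPExact.DF V (boolPair p.1 (boolPair p.2.1 p.2.2)) = [V.decide p.1 p.2.1 p.2.2]
    exact PCPExact.DF_record _ _ _

/-- Blocks of length `1` are the items. [folklore] -/
theorem chunks_one (w : List Bool) :
    (List.range w.length).map (fun i => (w.drop (i * 1)).take 1) = w.map fun b => [b] := by
  refine List.ext_getElem (by simp) fun i h1 h2 => ?_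
  rw [List.getElem_map, List.getElem_map, List.getElem_range, mul_one]
  have hi : i < w.length := by simpa using h2
  rw [List.drop_eq_getElem_cons hi, List.take_succ_cons, List.take_zero]

/-- **A string as the raw list of its bits.** [folklore] -/
theorem strBits : CodeFP strE (rawE bitE) (id : List Bool → List Bool) := by
  have h : CodeFP strE (rawE strE) (fun w => (List.range w.length).map fun i => (w.drop (i * 1)).take 1) :=
    (strChunks.comp (strLength.pair ((const strE 1).pair (CodeFP.id strE)))).congr fun _ => rfl
  refine h.recodeOut fun w => ?_
  rw [chunks_one]
  simp only [rawE, List.map_map]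
  rfl

/-! ### The formula of a coin string -/

/-- **The formula of a coin string is polynomial time** on `((x, Pos), ρ)`. [cite: AroraBarakCC2009, §1.3; Hirahara2022PartialMCSP, proof of Thm. 5.2] -/
theorem codeFP_formulaT {V : PCPVerifier} (hV : V.IsPolyTime) (q : ℕ) :
    CodeFP (pairE (pairE strE (rawE natE)) strE) (rawE (rawE natE)) (fun t => formulaT V q t.1.1 t.1.2 t.2) := by
  -- the data
  have hx : CodeFP (pairE (pairE strE (rawE natE)) strE) strE (fun t => t.1.1) := (fst _ _).fst'
  have hPos : CodeFP (pairE (pairE strE (rawE natE)) strE) (rawE natE) (fun t => t.1.2) := (fst _ _).snd'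
  have hρ : CodeFP (pairE (pairE strE (rawE natE)) strE) strE (fun t => t.2) := snd _ _
  have hqs : CodeFP (pairE (pairE strE (rawE natE)) strE) (rawE natE) (fun t => V.queries t.1.1 t.2) :=
    (codeFP_queries hV).comp (hx.pair hρ)
  have hk : CodeFP (pairE (pairE strE (rawE natE)) strE) unE (fun t => (V.queries t.1.1 t.2).length) :=
    (ulength natE).comp hqs
  -- all answer vectors
  have hvecs : CodeFP (pairE (pairE strE (rawE natE)) strE) (rawE strE)
      (fun t => (List.range (min (2 ^ (V.queries t.1.1 t.2).length) (2 ^ q))).map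
        (PCPExact.coinStr (V.queries t.1.1 t.2).length)) :=
    codeFP_coinStringsOf.comp (hk.pair (const _ (2 ^ q)))
  -- the accepting ones: filter with context `(x, ρ)`
  have hdec : CodeFP (pairE (pairE strE strE) strE) bitE (fun s => V.decide s.1.1 s.1.2 s.2) :=
    (codeFP_decide hV).comp ((fst _ _).fst'.pair ((fst _ _).snd'.pair (snd _ _)))
  have hacc : CodeFP (pairE (pairE strE (rawE natE)) strE) (rawE strE)
      (fun t => ((List.range (min (2 ^ (V.queries t.1.1 t.2).length) (2 ^ q))).map
        (PCPExact.coinStr (V.queries t.1.1 t.2).length)).filter (V.decide t.1.1 t.2)) :=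
    ((filter hdec).comp ((hx.pair hρ).pair hvecs)).congr fun _ => rfl
  -- the term of a vector: context `(Pos, qs)`, item `a`
  have hzip : CodeFP (pairE (rawE natE) (pairE (rawE natE) (rawE bitE))) (rawE natE)
      (fun s => List.zipWith (fun p b => litVar s.1 (p, b)) s.2.1 s.2.2) :=
    zipWith codeFP_litVar
  have hterm : CodeFP (pairE (pairE (rawE natE) (rawE natE)) strE) (rawE natE)
      (fun s => List.zipWith (fun p b => litVar s.1.1 (p, b)) s.1.2 s.2) :=
    (hzip.comp ((fst _ _).fst'.pair ((fst _ _).snd'.pair (strBits.comp (snd _ _))))).congr fun _ => rfl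
  have hmap : CodeFP (pairE (pairE (rawE natE) (rawE natE)) (rawE strE)) (rawE (rawE natE))
      (fun s => s.2.map fun a => List.zipWith (fun p b => litVar s.1.1 (p, b)) s.1.2 a) := map hterm
  exact (hmap.comp ((hPos.pair hqs).pair hacc)).congr fun _ => rfl

/-! ### The instance map -/

/-- The query occurrence list is polynomial time. [folklore] -/
theorem codeFP_posList {V : PCPVerifier} (hV : V.IsPolyTime) (c : ℕ) :
    CodeFP strE (rawE natE) (fun x => posList V x (mOf c x)) :=
  ((flatten natE).comp ((map (codeFP_queries hV)).comp ((CodeFP.id strE).pair (codeFP_coinStrings c)))).congr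
    fun _ => rfl

/-- The formulas are polynomial time (raw codes). [cite: AroraBarakCC2009, §1.3] -/
theorem codeFP_formulasOf {V : PCPVerifier} (hV : V.IsPolyTime) (c q : ℕ) :
    CodeFP strE (rawE (rawE (rawE natE))) (fun x => (coinStrings (mOf c x)).map (formulaT V q x (posList V x (mOf c x)))) := by
  have hctx : CodeFP strE (pairE (pairE strE (rawE natE)) (rawE strE))
      (fun x => ((x, posList V x (mOf c x)), coinStrings (mOf c x))) :=
    ((CodeFP.id strE).pair (codeFP_posList hV c)).pair (codeFP_coinStrings c)
  have h := (map (codeFP_formulaT hV q)).comp hctx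
  exact h.congr fun x => rfl

/-- **The instance tuple is polynomial time.** [cite: AroraBarakCC2009, §1.3 and Thm. 11.9 (proof)] -/
theorem codeFP_instT {V : PCPVerifier} (hV : V.IsPolyTime) (c q : ℕ) :
    CodeFP strE toE (fun x => (instT V c q x : TO)) := by
  have hPos := codeFP_posList hV c
  have hN : CodeFP strE natE (fun x => (posList V x (mOf c x)).length) := (natLength natE).comp hPos
  have h1 : CodeFP strE natE (fun x => 2 * (posList V x (mOf c x)).length) := natMul.comp ((const _ 2).pair hN)
  have h2 : CodeFP strE (listE (listE (listE natE)))
      (fun x => (coinStrings (mOf c x)).map (formulaT V q x (posList V x (mOf c x)))) :=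
    (codeFP_collList.comp (codeFP_formulasOf hV c q)).congr fun _ => rfl
  have h3 : CodeFP strE (listE unE) (fun x => weights (posList V x (mOf c x))) :=
    ((listOfRaw unE).comp (codeFP_weights.comp hPos)).congr fun _ => rfl
  exact (h1.pair (h2.pair (h3.pair hN))).congr fun x => rfl

/-- **`x ↦ toCMMSA V x (c log₂|x| + c)` is computed by a polynomial-time string function** (for a
polynomial-time `q`-query verifier). [cite: AroraBarakCC2009, Thm. 11.9 (proof: the map from the PCP theorem); §1.3] -/
theorem codeFP_toCMMSA {V : PCPVerifier} (hV : V.IsPolyTime) {c q : ℕ} (hq : ∀ x ρ, (V.queries x ρ).length ≤ q) :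
    CodeFP strE CMMSAInstance.encoding.encode (fun x => toCMMSA V x (mOf c x)) := by
  obtain ⟨f, hf, hfd⟩ := codeFP_instT hV c q
  refine ⟨f, hf, fun x => ?_⟩
  rw [CMMSAInstance.encoding_encode, toE_eq, hfd]
  show toE (instT V c q x) = toE (toCMMSA V x (mOf c x)).toTuple
  rw [instT_eq hq]

/-! ### The Karp reduction and NP-hardness -/

/-- **`L ≤ₚ gapCMMSA (gapQ q) 1 (2^q·q)` for every `L ∈ PCPExact(c log₂ n + c, q)`.**
[cite: AroraBarakCC2009, Thm. 11.9 (from Thm. 11.5); Hirahara2022PartialMCSP, proof of Thm. 5.2] -/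
theorem polyTimeReducible_of_mem_PCPExact {L : Language Bool} {c q : ℕ}
    (hL : L ∈ PCPExact (fun n => c * Nat.log 2 n + c) (fun _ => q)) :
    (PromiseProblem.ofLanguage L).PolyTimeReducible (gapCMMSA (fun _ => gapQ q) (fun _ => 1) fun _ => 2 ^ q * q) := by
  obtain ⟨V, hV, hcoins, hq, hcomp, hsound⟩ := hL
  obtain ⟨f, hf, hfx⟩ := codeFP_toCMMSA hV (c := c) hq
  refine ⟨f, hf, fun x hx => ?_, fun x hx => ?_⟩
  · have hfx' : f x = CMMSAInstance.encoding.encode (toCMMSA V x (mOf c x)) := hfx x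
    rw [hfx', gapCMMSA_yes]
    exact Set.mem_image_of_mem _ (toCMMSA_mem_yesSet (hq x) (hcoins x.length) (hcomp x hx))
  · have hfx' : f x = CMMSAInstance.encoding.encode (toCMMSA V x (mOf c x)) := hfx x
    rw [hfx', gapCMMSA_no]
    exact Set.mem_image_of_mem _ (toCMMSA_mem_noSet (hq x) (hcoins x.length) (hsound x hx))

/-- **From the PCP theorem, a constant-gap CMMSA problem of constant degree is NP-hard**: with the
verifier of `3SAT` reading `q` bits, `gapCMMSA (gapQ q) 1 (2^q · q)` is NP-hard (Cook–Levin composed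
with the reduction of the verifier). [cite: AroraBarakCC2009, Thm. 11.9 (PCP theorem ⇒ gap hardness) with Thm. 2.10; AlekhnovichEtAl2001, §2] -/
theorem isNPHard_gapCMMSA_of_pcp_theorem (h : pcp_theorem_exact) :
    ∃ q : ℕ, (gapCMMSA (fun _ => gapQ q) (fun _ => 1) fun _ => 2 ^ q * q).IsNPHard := by
  obtain ⟨c, q, hV⟩ := h.NP_subset isNPComplete_kSAT_three_holds.1
  refine ⟨q, fun L hL => ?_⟩
  obtain ⟨r, hr, hspec⟩ := isNPComplete_kSAT_three_holds.2 L hL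
  have h3 : (PromiseProblem.ofLanguage L).PolyTimeReducible (PromiseProblem.ofLanguage (kSAT 3)) :=
    ⟨r, hr, fun x hx => (hspec x).1 hx, fun x hx h3 => hx ((hspec x).2 h3)⟩
  exact PromiseProblem.PolyTimeReducible.trans_holds h3 (polyTimeReducible_of_mem_PCPExact hV)

end PCPToCMMSA

end Literature.Computability.Complexity
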